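import Mathlib
import Summits.ValiantsHypothesis.ValiantsHypothesis.Theorems.DivisionGapPerMultiplesHardStubZRigidity

/-!
# Relative `Z`-capture (line `uncharged-face-walk` of crux `PerMultiplesHard`, route
DivisionGap; stub `stub_zCaptureRel`)

Pure finite combinatorics on permutations of `Fin n`.  Fix a set `Z` of row shifts (permutations
of `Fin n`), a row set `S`, a column set `T` and a comparison set `P` of permutations.  A
permutation `π` is `Z`-COMPATIBLE with the typed rectangle `(S, T)` when
(a) every `i ∈ S` has `π⁻¹ (ζ i) ∈ T` for some `ζ ∈ Z`, and
(b) every `j ∈ T` has `π j = ζ i` for some `ζ ∈ Z` and `i ∈ S`.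

Compatibility depends on `π` only through the image `U := π(T)`: (b) says
`U ⊆ W := ⋃_{ζ ∈ Z} ζ(S)` (and `#W ≤ #Z · #S`, `card_shiftUnion_le`), (a) says every `i ∈ S` has
`ζ i ∈ U` for some `ζ ∈ Z`, and `#U = #T` since `π` is injective (`image_valid_of_compatible`).
Hence the compatible part of `P` is covered by the fibres `{π ∈ P : π(T) = U}` over the
`U ⊆ W` with `#U = #T`, of which there are at most `C(#W, #T) ≤ C(#Z · #S, #T)`; if every fibre
has at most `M` elements, the compatible part of `P` has at most `C(#Z · #S, #T) · M` elements
(`card_compatible_le`).  Moreover a compatible `π` exists only if `#S ≤ #Z · #T`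
(`S ⊆ ⋃_{ζ ∈ Z} ζ⁻¹(U)`) and `#T ≤ #Z · #S` (`U ⊆ W`) (`card_bounds_of_compatible`).  The
registered stub `stub_zCaptureRel` is the conjunction.

-- adapted from Theorems/DivisionGapPerMultiplesHardStubZRigidity.lean (`stub_zRigidity`,
steps (1)–(4), with `Finset.univ` replaced by the comparison set `P` and the fibre bound
abstracted to the hypothesis `≤ M`) and from the `2`-cell sibling
Theorems/DivisionGapPerMultiplesHardStubSpreadCaptureRel.lean (same layout, `W = S ∪ ζ(S)`).
-/

noncomputable section

-- the namespace `Summit.ValiantsHypothesis.ValiantsHypothesis.…` is mandated by the crux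
-- (registered stub names)
set_option linter.dupNamespace false

namespace Summit.ValiantsHypothesis.ValiantsHypothesis.Theorems.DivisionGap.PerMultiplesHard.ZCaptureRel

open scoped BigOperators

/-- **The shift union is small.**  `#(⋃_{ζ ∈ Z} ζ(S)) ≤ #Z · #S`. [folklore] -/
theorem card_shiftUnion_le {n : ℕ} (Z : Finset (Equiv.Perm (Fin n))) (S : Finset (Fin n)) :
    (Z.biUnion fun ζ => S.image ⇑ζ).card ≤ Z.card * S.card :=
  Finset.card_biUnion_le_card_mul _ _ _ fun _ _ => Finset.card_image_le

/-- **Compatibility is a property of the image.**  If `π` is `Z`-compatible with `(S, T)`, then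
`U := π(T)` lies in `⋃_{ζ ∈ Z} ζ(S)`, has `#U = #T`, and every `i ∈ S` has `ζ i ∈ U` for some
`ζ ∈ Z`. [folklore] -/
theorem image_valid_of_compatible {n : ℕ} (Z : Finset (Equiv.Perm (Fin n)))
    (S T : Finset (Fin n)) (π : Equiv.Perm (Fin n))
    (ha : ∀ i ∈ S, ∃ ζ ∈ Z, π.symm (ζ i) ∈ T)
    (hb : ∀ j ∈ T, ∃ ζ ∈ Z, ∃ i ∈ S, ζ i = π j) :
    T.image ⇑π ⊆ Z.biUnion (fun ζ => S.image ⇑ζ) ∧ (T.image ⇑π).card = T.card ∧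
      ∀ i ∈ S, ∃ ζ ∈ Z, ζ i ∈ T.image ⇑π := by
  refine ⟨?_, Finset.card_image_of_injective _ π.injective, ?_⟩
  · intro x hx
    rw [Finset.mem_image] at hx
    obtain ⟨j, hj, rfl⟩ := hx
    obtain ⟨ζ, hζ, i, hi, h⟩ := hb j hj
    rw [Finset.mem_biUnion]
    exact ⟨ζ, hζ, Finset.mem_image.mpr ⟨i, hi, h⟩⟩
  · intro i hi
    obtain ⟨ζ, hζ, h⟩ := ha i hi
    exact ⟨ζ, hζ, Finset.mem_image.mpr ⟨_, h, π.apply_symm_apply _⟩⟩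

/-- **Size constraints from one compatible permutation.**  If some `π` is `Z`-compatible with
`(S, T)`, then `#S ≤ #Z · #T` (the set `S` is covered by `⋃_{ζ ∈ Z} ζ⁻¹(U)` for `U := π(T)`,
`#U = #T`) and `#T ≤ #Z · #S` (`U ⊆ ⋃_{ζ ∈ Z} ζ(S)`). [folklore] -/
theorem card_bounds_of_compatible {n : ℕ} (Z : Finset (Equiv.Perm (Fin n)))
    (S T : Finset (Fin n)) (π : Equiv.Perm (Fin n))
    (ha : ∀ i ∈ S, ∃ ζ ∈ Z, π.symm (ζ i) ∈ T)
    (hb : ∀ j ∈ T, ∃ ζ ∈ Z, ∃ i ∈ S, ζ i = π j) :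
    S.card ≤ Z.card * T.card ∧ T.card ≤ Z.card * S.card := by
  obtain ⟨hUW, hUcard, hcov⟩ := image_valid_of_compatible Z S T π ha hb
  set U : Finset (Fin n) := T.image ⇑π with hU
  constructor
  · have hSsub : S ⊆ Z.biUnion fun ζ => U.image ⇑ζ.symm := by
      intro i hi
      obtain ⟨ζ, hζ, h⟩ := hcov i hi
      rw [Finset.mem_biUnion]
      exact ⟨ζ, hζ, Finset.mem_image.mpr ⟨ζ i, h, ζ.symm_apply_apply i⟩⟩
    calc S.card ≤ (Z.biUnion fun ζ => U.image ⇑ζ.symm).card := Finset.card_le_card hSsub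
      _ ≤ Z.card * U.card :=
          Finset.card_biUnion_le_card_mul _ _ _ fun _ _ => Finset.card_image_le
      _ = Z.card * T.card := by rw [hUcard]
  · calc T.card = U.card := hUcard.symm
      _ ≤ (Z.biUnion fun ζ => S.image ⇑ζ).card := Finset.card_le_card hUW
      _ ≤ Z.card * S.card := card_shiftUnion_le Z S

/-- **Relative capture count.**  Fix `Z`, `S`, `T` and a comparison set `P`.  If every fibre
`{π ∈ P : π(T) = U}` over a `U ⊆ ⋃_{ζ ∈ Z} ζ(S)` with `#U = #T` has at most `M` elements, then
the part of `P` that is `Z`-compatible with `(S, T)` has at most `C(#Z · #S, #T) · M` elements: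
it is covered by the fibres over the images `U ⊆ W := ⋃_{ζ ∈ Z} ζ(S)` with `#U = #T`, and there
are `C(#W, #T) ≤ C(#Z · #S, #T)` of those. [folklore] -/
theorem card_compatible_le {n : ℕ} (Z : Finset (Equiv.Perm (Fin n))) (S T : Finset (Fin n))
    (P : Finset (Equiv.Perm (Fin n))) (M : ℕ)
    (hM : ∀ U : Finset (Fin n), U ⊆ Z.biUnion (fun ζ => S.image ⇑ζ) → U.card = T.card →
      (P.filter fun π : Equiv.Perm (Fin n) => T.image ⇑π = U).card ≤ M) :
    (P.filter fun π : Equiv.Perm (Fin n) =>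
        (∀ i ∈ S, ∃ ζ ∈ Z, π.symm (ζ i) ∈ T) ∧
        (∀ j ∈ T, ∃ ζ ∈ Z, ∃ i ∈ S, ζ i = π j)).card ≤ (Z.card * S.card).choose T.card * M := by
  -- the pieces of the count
  set u : ℕ := T.card with hu
  set W : Finset (Fin n) := Z.biUnion fun ζ => S.image ⇑ζ with hW
  set V : Finset (Finset (Fin n)) := W.powersetCard u with hV
  set Fib : Finset (Fin n) → Finset (Equiv.Perm (Fin n)) := fun U =>
    P.filter fun π : Equiv.Perm (Fin n) => T.image ⇑π = U with hFib
  set C : Finset (Equiv.Perm (Fin n)) :=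
    P.filter fun π : Equiv.Perm (Fin n) =>
      (∀ i ∈ S, ∃ ζ ∈ Z, π.symm (ζ i) ∈ T) ∧
      (∀ j ∈ T, ∃ ζ ∈ Z, ∃ i ∈ S, ζ i = π j) with hC
  -- (1) compatibility depends only on the image `π(T)`, which lies in `W` and has size `u`
  have hsub : C ⊆ V.biUnion Fib := by
    intro π hπ
    rw [hC, Finset.mem_filter] at hπ
    obtain ⟨hπP, ha, hb⟩ := hπ
    obtain ⟨hUW, hUcard, -⟩ := image_valid_of_compatible Z S T π ha hb
    rw [Finset.mem_biUnion]
    refine ⟨T.image ⇑π, ?_, ?_⟩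
    · rw [hV, Finset.mem_powersetCard]
      exact ⟨hUW, hUcard⟩
    · rw [hFib, Finset.mem_filter]
      exact ⟨hπP, rfl⟩
  -- (2) there are at most `C(#Z · #S, u)` such images
  have hVcard : V.card ≤ (Z.card * S.card).choose u := by
    calc V.card = W.card.choose u := Finset.card_powersetCard _ _
      _ ≤ (Z.card * S.card).choose u := Nat.choose_le_choose u (card_shiftUnion_le Z S)
  -- (3) each fibre has at most `M` elements, so `#C ≤ C(#Z · #S, u) · M`
  calc C.card ≤ (V.biUnion Fib).card := Finset.card_le_card hsub
    _ ≤ ∑ U ∈ V, (Fib U).card := Finset.card_biUnion_le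
    _ ≤ ∑ _U ∈ V, M := by
        refine Finset.sum_le_sum fun U hUV => ?_
        rw [hV, Finset.mem_powersetCard] at hUV
        exact hM U hUV.1 hUV.2
    _ = V.card * M := by rw [Finset.sum_const, smul_eq_mul]
    _ ≤ (Z.card * S.card).choose u * M := Nat.mul_le_mul_right _ hVcard

/-- **stub_zCaptureRel — `Z`-compatible sets split into few block-diagonal fibres, inside any
`P`** (registered stub; the `Z`-analogue of `SpreadCaptureRel.stub_spreadCaptureRel`, steps
(1)–(4) of `ZRigidity.stub_zRigidity` with `Finset.univ` replaced by `P`).  Fix a shift set `Z`,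
`S`, `T`, `P`.  `Z`-compatibility of `π` with `(S, T)` (`∀ i ∈ S, ∃ ζ ∈ Z, π⁻¹(ζ i) ∈ T` and
`∀ j ∈ T, ∃ ζ ∈ Z, ∃ i ∈ S, ζ i = π j`) depends only on `U := π(T)`:
`U ⊆ W := ⋃_{ζ ∈ Z} ζ(S)` (`#W ≤ #Z · #S`), `#U = #T`; so if every fibre `{π ∈ P : π(T) = U}`
with `U ⊆ W`, `#U = #T` has at most `M` elements, the compatible part of `P` has at most
`C(#Z · #S, #T) · M` elements; and a compatible `π` exists only if `#S ≤ #Z · #T` (every `i ∈ S`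
has some `ζ i ∈ U`, and `u ∈ U` serves at most `#Z` rows `i = ζ⁻¹ u`) and `#T ≤ #Z · #S`.
[folklore] -/
theorem stub_zCaptureRel :
    ∀ (n : ℕ) (Z : Finset (Equiv.Perm (Fin n))) (S T : Finset (Fin n))
      (P : Finset (Equiv.Perm (Fin n))) (M : ℕ),
      (∀ U : Finset (Fin n), U ⊆ Z.biUnion (fun ζ => S.image ⇑ζ) → U.card = T.card →
        (P.filter fun π : Equiv.Perm (Fin n) => T.image ⇑π = U).card ≤ M) →
      (P.filter fun π : Equiv.Perm (Fin n) => (∀ i ∈ S, ∃ ζ ∈ Z, π.symm (ζ i) ∈ T) ∧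
          (∀ j ∈ T, ∃ ζ ∈ Z, ∃ i ∈ S, ζ i = π j)).card ≤ (Z.card * S.card).choose T.card * M ∧
      ((P.filter fun π : Equiv.Perm (Fin n) => (∀ i ∈ S, ∃ ζ ∈ Z, π.symm (ζ i) ∈ T) ∧
          (∀ j ∈ T, ∃ ζ ∈ Z, ∃ i ∈ S, ζ i = π j)).Nonempty →
        S.card ≤ Z.card * T.card ∧ T.card ≤ Z.card * S.card) := by
  intro n Z S T P M hM
  refine ⟨card_compatible_le Z S T P M hM, ?_⟩
  rintro ⟨π, hπ⟩
  rw [Finset.mem_filter] at hπ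
  exact card_bounds_of_compatible Z S T π hπ.2.1 hπ.2.2

end Summit.ValiantsHypothesis.ValiantsHypothesis.Theorems.DivisionGap.PerMultiplesHard.ZCaptureRel

end
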